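import Summits.CriticalPhenomena.CardyFormulaZ2.Theorems.UnionJackBeffaraDefs
import Literature.Probability.Percolation.SmirnovSeparatingData
import Literature.Probability.RandomPlanarGeometry.CollarDomain

/-!
# Crux `UnionJackMorera` (stmt-CriticalPhenomena-4558), line `registered` — RSW-free glue for Stub A: the geometry of `ujFaceAt` and the collar approximating families

Route `UnionJackBeffara` (sub-problem `CriticalPhenomena/CardyFormulaZ2`); skeleton
`Cruxes/UnionJackMorera/Lines/birth.lean`, definitions module `Theorems/UnionJackBeffaraDefs.lean`
(`UJApprox`, `IsUJDataRSW`). The registered stub `stub_ujSeparatingData` (the RSW half of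
Smirnov's separating data on the Union-Jack lattice `G_s`) is NOT proved here: it needs a `G_s`
percolation toolkit absent from the tree (RSW box crossings, one-arm bounds, crude-domain
duality/topology, a boundary-collar arm estimate; audit `stub_ujSeparatingData.md` attached to the
item, worker W1 of lead `prover-line-stmt-CriticalPhenomena-4558-0`, 2026-08-17). This file lands
the RSW-FREE lemmas of the intended proof, all sorry-free, carried by the registered glue sub-goal
`stub_ujCollarApprox` (last theorem):

* geometry of `ujFaceAt` (every vertex of the triangle read at `c`, mesh `δ`, is within `δ` of
  `c`), so triangles read on a compactum `K ⊆ Ω` are crude-domain triangles off every crude arc,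
  eventually, also along any `UJApprox` family;
* the inner/outer **collar families** `δ ↦ forgetLast (R.collarRect T σ (w δ))` (the tree's
  `CollarDomain.lean`; Bollobás–Riordan's longer–thinner / shorter–fatter domains, Ch. 7 p. 186)
  are `UJApprox` families whenever `w δ → 0` (`ujApprox_collarFamily`): the candidates for `T^∓`.
-/

noncomputable section

open Set Filter Topology Metric MeasureTheory
open Literature.Probability.LatticeModels Literature.Probability.Percolation
open Literature.Probability.RandomPlanarGeometry Literature.Probability.RandomPlanarGeometry.MarkedDomain

namespace Summit.CriticalPhenomena.CardyFormulaZ2.Cruxes.UnionJackMorera.Birth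

/-! ### Geometry of `ujFaceAt`: the triangle read at a point is within one mesh of it -/

/-- The vertices of a triangle `t = (f, s)` of `G_s` are the centre of the square `f` or one of its
four corners. [folklore] -/
theorem ujFaceVert_mem (t : UJFace) (j : Fin 3) :
    ujFaceVert t j = Sum.inr t.1 ∨ ∃ s : Fin 4, ujFaceVert t j = Sum.inl (ujCorner t.1 s) := by
  fin_cases j
  · exact Or.inl rfl
  · exact Or.inr ⟨t.2, rfl⟩
  · exact Or.inr ⟨t.2 + 1, rfl⟩

/-- In the coordinates `X = Re w - Im w + 1/2`, `Y = Re w + Im w - 1/2` (the `ℤ²`-frame of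
Beffara's picture, in which `unionJackEmbed (inl (a, b))` has coordinates `(a, b)` and the centre
`inr (k, l)` has coordinates `(k + 1/2, l + 1/2)`), the squared distance of two points of the plane
is half the sum of the squares of the coordinate differences. [folklore] -/
theorem normSq_eq_half_frame (w v : ℂ) :
    Complex.normSq (w - v) =
      (((w.re - w.im) - (v.re - v.im)) ^ 2 + ((w.re + w.im) - (v.re + v.im)) ^ 2) / 2 := by
  rw [Complex.normSq_apply]
  simp only [Complex.sub_re, Complex.sub_im]
  ring

/-- **Every vertex of the triangle of `G_s` containing `w` lies within distance `1` of `w`** (in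
fact within `1/√2`: the triangle has the point in its closure and diameter `1/√2`; the cruder
bound follows from `|ΔX|, |ΔY| ≤ 1` for the centre and the four corners of the square read off
the integer parts of the frame coordinates `X, Y`). [folklore] -/
theorem dist_ujFaceVert_ujFaceAt_le_one (w : ℂ) (j : Fin 3) :
    dist (unionJackEmbed (ujFaceVert (ujFaceAt w) j)) w ≤ 1 := by
  -- the square of `ujFaceAt w`
  set X : ℝ := w.re - w.im + 1 / 2 with hX
  set Y : ℝ := w.re + w.im - 1 / 2 with hY
  have hsq : (ujFaceAt w).1 = (⌊X⌋, ⌊Y⌋) := rfl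
  have hfX0 : (0 : ℝ) ≤ Int.fract X := Int.fract_nonneg X
  have hfX1 : Int.fract X < 1 := Int.fract_lt_one X
  have hfY0 : (0 : ℝ) ≤ Int.fract Y := Int.fract_nonneg Y
  have hfY1 : Int.fract Y < 1 := Int.fract_lt_one Y
  have hXd : (⌊X⌋ : ℝ) = X - Int.fract X := by rw [Int.fract]; ring
  have hYd : (⌊Y⌋ : ℝ) = Y - Int.fract Y := by rw [Int.fract]; ring
  -- reduce to a bound on `normSq`
  rw [dist_eq_norm]
  have key : Complex.normSq (unionJackEmbed (ujFaceVert (ujFaceAt w) j) - w) ≤ 1 := by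
    rcases ujFaceVert_mem (ujFaceAt w) j with h | ⟨s, h⟩
    · rw [h, hsq, normSq_eq_half_frame, unionJackEmbed_inr]
      simp only [Complex.div_ofNat_re, Complex.add_re, Complex.intCast_re, Complex.mul_re,
        Complex.I_re, mul_zero, Complex.intCast_im, Complex.I_im, mul_one, sub_self,
        Complex.div_ofNat_im, Complex.add_im, Complex.mul_im, zero_add, add_zero]
      push_cast
      rw [hXd, hYd]
      nlinarith [hfX0, hfX1, hfY0, hfY1]
    · rw [h, hsq, normSq_eq_half_frame, unionJackEmbed_inl]
      fin_cases s <;>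
      · simp only [ujCorner, Complex.div_ofNat_re,
          Complex.add_re, Complex.intCast_re, Complex.mul_re, Complex.I_re, mul_zero,
          Complex.intCast_im, Complex.I_im, mul_one, sub_self, Complex.div_ofNat_im,
          Complex.add_im, Complex.mul_im, zero_add, add_zero]
        push_cast
        rw [hXd, hYd]
        nlinarith [hfX0, hfX1, hfY0, hfY1]
  have h2 : ‖unionJackEmbed (ujFaceVert (ujFaceAt w) j) - w‖ ^ 2 ≤ 1 := by
    rw [← Complex.normSq_eq_norm_sq]; exact key
  nlinarith [norm_nonneg (unionJackEmbed (ujFaceVert (ujFaceAt w) j) - w)]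


/-- **Scaled form**: at mesh `δ > 0`, every vertex of the triangle of `δ · G_s` read at the
continuum point `c` (the triangle `ujFaceAt (c/δ)` through which `ujSepProbFun` reads `H^δ`) lies
within `δ` of `c`. [folklore] -/
theorem dist_smul_ujFaceVert_ujFaceAt_le {δ : ℝ} (hδ : 0 < δ) (c : ℂ) (j : Fin 3) :
    dist ((δ : ℂ) * unionJackEmbed (ujFaceVert (ujFaceAt (c / δ)) j)) c ≤ δ := by
  have h := dist_ujFaceVert_ujFaceAt_le_one (c / δ) j
  have hδ' : (δ : ℂ) ≠ 0 := by exact_mod_cast hδ.ne'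
  have hc : (δ : ℂ) * (c / δ) = c := mul_div_cancel₀ _ hδ'
  calc dist ((δ : ℂ) * unionJackEmbed (ujFaceVert (ujFaceAt (c / δ)) j)) c
      = dist ((δ : ℂ) * unionJackEmbed (ujFaceVert (ujFaceAt (c / δ)) j)) ((δ : ℂ) * (c / δ)) := by
        rw [hc]
    _ = δ * dist (unionJackEmbed (ujFaceVert (ujFaceAt (c / δ)) j)) (c / δ) := by
        rw [dist_eq_norm, ← mul_sub, norm_mul, Complex.norm_real, Real.norm_eq_abs, abs_of_pos hδ,
          ← dist_eq_norm]
    _ ≤ δ * 1 := mul_le_mul_of_nonneg_left h hδ.le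
    _ = δ := mul_one δ

/-- `ujSepProbFun` reads the separating probability of the triangle containing the point
(unfolding lemma). [cite: Beffara2008Universal, §3 (arXiv p. 11)] -/
theorem ujSepProbFun_apply (T : MarkedDomain 3) (δ : ℝ) (i : Fin 3) (c : ℂ) :
    ujSepProbFun T δ i c = ujSepProb T δ i (ujFaceAt (c / δ)) := rfl

/-- At the sample points `δ · hexCenter x` of the `interior` clause (`x` a face of the triangular
lattice) `ujSepProbFun` reads the triangle `ujFaceAt (hexCenter x)` of `G_s`. [folklore] -/
theorem ujSepProbFun_apply_hexCenter (T : MarkedDomain 3) {δ : ℝ} (hδ : δ ≠ 0) (i : Fin 3)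
    (x : HexVertex) :
    ujSepProbFun T δ i ((δ : ℂ) * hexCenter x) = ujSepProb T δ i (ujFaceAt (hexCenter x)) := by
  have hδ' : (δ : ℂ) ≠ 0 := by exact_mod_cast hδ
  rw [ujSepProbFun_apply, mul_div_cancel_left₀ _ hδ']

/-- **Compacta have their `G_s`-triangles inside, eventually**: if `K` is a compact subset of the
open set `Ω`, then for all small `δ > 0` the triangle of `δ · G_s` read at any point of `K` is a
triangle of the crude discrete domain `ujFaces Ω δ` (all three vertices embedded in `Ω`) — so
`H^δ_i` is read there off genuine domain triangles, outside the junk regime of `ujSepEvent`.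
(Bollobás–Riordan p. 199: "as `C` is contained in the open set `D`, for `δ` sufficiently small we
have `C_δ ⊂ G_δ⁻`".) [cite: BollobasRiordan2006, Ch. 7 p. 199] -/
theorem eventually_ujFaceAt_mem_ujFaces {Ω K : Set ℂ} (hΩ : IsOpen Ω) (hK : IsCompact K)
    (hKΩ : K ⊆ Ω) : ∀ᶠ δ : ℝ in 𝓝[>] 0, ∀ c ∈ K, ujFaceAt (c / δ) ∈ ujFaces Ω δ := by
  obtain ⟨ρ, hρ, hρK⟩ := hK.exists_thickening_subset_open hΩ hKΩ
  filter_upwards [Ioo_mem_nhdsGT hρ] with δ hδ c hc j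
  show (δ : ℂ) * unionJackEmbed (ujFaceVert (ujFaceAt (c / δ)) j) ∈ Ω
  refine hρK (mem_thickening_iff.2 ⟨c, hc, ?_⟩)
  exact lt_of_le_of_lt (dist_smul_ujFaceVert_ujFaceAt_le hδ.1 c j) hδ.2

/-- **Along an approximating family** the triangles read at the points of a compactum `K ⊆ Ω` are
triangles of the crude discrete domain of `T δ`, eventually (clause (ii) of `UJApprox` applied to a
compact thickening of `K`). [cite: BollobasRiordan2006, Ch. 7 p. 199] -/
theorem UJApprox.eventually_ujFaceAt_mem_ujFaces {R : ConformalRectangle} {T : ℝ → MarkedDomain 3}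
    (hT : UJApprox R T) {K : Set ℂ} (hK : IsCompact K) (hKΩ : K ⊆ R.carrier) :
    ∀ᶠ δ : ℝ in 𝓝[>] 0, ∀ c ∈ K, ujFaceAt (c / δ) ∈ ujFaces (T δ).carrier δ := by
  obtain ⟨κ, hκ, hK'⟩ := hK.exists_cthickening_subset_open R.isOpen hKΩ
  have h1 := hT.2 (cthickening κ K) hK.cthickening hK'
  filter_upwards [h1, Ioc_mem_nhdsGT hκ] with δ hδ hδκ c hc j
  show (δ : ℂ) * unionJackEmbed (ujFaceVert (ujFaceAt (c / δ)) j) ∈ (T δ).carrier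
  refine hδ (mem_cthickening_of_dist_le _ c _ _ hc ?_)
  exact (dist_smul_ujFaceVert_ujFaceAt_le hδκ.1 c j).trans hδκ.2

/-- In particular the `interior` sample points of a compactum are read off domain triangles of
`T δ`, eventually. [cite: BollobasRiordan2006, Ch. 7 p. 199] -/
theorem UJApprox.eventually_hexCenter_mem_ujFaces {R : ConformalRectangle} {T : ℝ → MarkedDomain 3}
    (hT : UJApprox R T) {K : Set ℂ} (hK : IsCompact K) (hKΩ : K ⊆ R.carrier) :
    ∀ᶠ δ : ℝ in 𝓝[>] 0, ∀ x : HexVertex, (δ : ℂ) * hexCenter x ∈ K →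
      ujFaceAt (hexCenter x) ∈ ujFaces (T δ).carrier δ := by
  filter_upwards [hT.eventually_ujFaceAt_mem_ujFaces hK hKΩ, self_mem_nhdsWithin] with δ hδ hδ0 x hx
  have hδ' : (δ : ℂ) ≠ 0 := by exact_mod_cast (ne_of_gt hδ0)
  have := hδ _ hx
  rwa [mul_div_cancel_left₀ _ hδ'] at this

/-! ### Deep sample triangles have no vertex on a crude arc -/

/-- **Triangles read inside a compactum touch no crude arc, eventually**: if `K` is a compact subset
of the open set `Ω` and `A` is disjoint from `Ω` (e.g. a boundary arc, `A ⊆ frontier Ω`), then for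
all small `δ > 0` no vertex of the triangle read at a point of `K` lies on the crude arc
`ujArcSites Ω δ A` (sites of `Ω` within `2δ` of `A`): those vertices are within `δ` of `K`, hence at
distance `> 2δ` from `Ωᶜ ⊇ A` once `3δ` is below the thickening radius of `K` in `Ω`. (So the junk
regime "`H_i = 0` because a vertex lies on the band of `A_i`" never occurs at deep sample points.
`A` must be nonempty: the crude arc of `∅` is, by the junk value `infDist _ ∅ = 0`, all of
`ujSites Ω δ`.) [folklore] -/
theorem eventually_ujFaceVert_notMem_ujArcSites {Ω K : Set ℂ} (hΩ : IsOpen Ω) (hK : IsCompact K)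
    (hKΩ : K ⊆ Ω) : ∀ᶠ δ : ℝ in 𝓝[>] 0, ∀ c ∈ K, ∀ (j : Fin 3) (A : Set ℂ), A.Nonempty → Disjoint A Ω →
      ujFaceVert (ujFaceAt (c / δ)) j ∉ ujArcSites Ω δ A := by
  obtain ⟨ρ, hρ, hρK⟩ := hK.exists_thickening_subset_open hΩ hKΩ
  have h3 : ∀ᶠ δ : ℝ in 𝓝[>] 0, δ ∈ Ioo 0 (ρ / 3) := Ioo_mem_nhdsGT (by positivity)
  filter_upwards [h3] with δ hδ c hc j A hAne hA hmem
  -- the vertex `y` is within `δ` of `c`, and within `2δ` of `A`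
  set y : ℂ := (δ : ℂ) * unionJackEmbed (ujFaceVert (ujFaceAt (c / δ)) j) with hy
  have hyc : dist y c ≤ δ := dist_smul_ujFaceVert_ujFaceAt_le hδ.1 c j
  have hyA : infDist y A ≤ 2 * δ := hmem.2
  -- some point of `A` is within `3δ < ρ` of `c`, hence in the thickening, hence in `Ω`: contradiction
  obtain ⟨a, ha, hya⟩ := (infDist_lt_iff hAne).1 (show infDist y A < ρ - δ by linarith [hδ.2])
  have haK : a ∈ thickening ρ K := by
    refine mem_thickening_iff.2 ⟨c, hc, ?_⟩
    calc dist a c ≤ dist a y + dist y c := dist_triangle a y c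
      _ < (ρ - δ) + δ := by rw [dist_comm a y]; linarith
      _ = ρ := by ring
  exact Set.disjoint_left.1 hA ha (hρK haK)

/-- **Along an approximating family**: the triangles read at the points of a compactum `K ⊆ Ω` have,
eventually, no vertex on any of the three crude arcs `ujArcSites (T δ).carrier δ ((T δ).arc i)` of
the crude discrete domain of `T δ` (the arcs lie on `frontier (T δ).carrier`, disjoint from the open
carrier, and a compact thickening of `K` is inside the carrier eventually). [folklore] -/
theorem UJApprox.eventually_ujFaceVert_notMem_ujArcSites {R : ConformalRectangle}
    {T : ℝ → MarkedDomain 3} (hT : UJApprox R T) {K : Set ℂ} (hK : IsCompact K)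
    (hKΩ : K ⊆ R.carrier) : ∀ᶠ δ : ℝ in 𝓝[>] 0, ∀ c ∈ K, ∀ (j : Fin 3) (i : Fin 3),
      ujFaceVert (ujFaceAt (c / δ)) j ∉ ujArcSites (T δ).carrier δ ((T δ).arc i) := by
  obtain ⟨κ, hκ, hK'⟩ := hK.exists_cthickening_subset_open R.isOpen hKΩ
  have h1 := hT.2 (cthickening κ K) hK.cthickening hK'
  have h3 : ∀ᶠ δ : ℝ in 𝓝[>] 0, δ ∈ Ioo 0 (κ / 3) := Ioo_mem_nhdsGT (by positivity)
  filter_upwards [h1, h3] with δ hδ hδκ c hc j i hmem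
  set y : ℂ := (δ : ℂ) * unionJackEmbed (ujFaceVert (ujFaceAt (c / δ)) j) with hy
  have hyc : dist y c ≤ δ := dist_smul_ujFaceVert_ujFaceAt_le hδκ.1 c j
  have hyA : infDist y ((T δ).arc i) ≤ 2 * δ := hmem.2
  have hAne : ((T δ).arc i).Nonempty := ⟨_, (T δ).pt_mem_arc_self i⟩
  obtain ⟨a, ha, hya⟩ := (infDist_lt_iff hAne).1
    (show infDist y ((T δ).arc i) < κ - δ by linarith [hδκ.2])
  have haK : a ∈ cthickening κ K := by
    refine mem_cthickening_of_dist_le a c κ K hc ?_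
    calc dist a c ≤ dist a y + dist y c := dist_triangle a y c
      _ ≤ (κ - δ) + δ := by rw [dist_comm a y]; linarith
      _ = κ := by ring
  -- `a` is on the frontier of the carrier, yet inside it
  have hafr : a ∈ frontier (T δ).carrier := (T δ).arc_subset_frontier i ha
  have hain : a ∈ (T δ).carrier := hδ haK
  rw [(T δ).isOpen.frontier_eq] at hafr
  exact hafr.2 hain

/-! ### Collar families are approximating families -/

section Collar

variable (R : ConformalRectangle) (T : R.toJordanDomain.TubeData) (σ : Fin 4 → ℝ) (w : ℝ → ℝ)

/-- The clamped collar width `min (1/2) (max (w δ) δ)`: positive for `δ > 0`, at most `1/2`, and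
tending to `0⁺` with `w`. [folklore] -/
def collarWidth (δ : ℝ) : ℝ := min (1 / 2) (max (w δ) δ)

/-- The clamped width is positive for positive mesh. [folklore] -/
theorem collarWidth_pos {δ : ℝ} (hδ : 0 < δ) : 0 < collarWidth w δ :=
  lt_min one_half_pos (hδ.trans_le (le_max_right _ _))

/-- The clamped width is at most `1/2`. [folklore] -/
theorem collarWidth_le (δ : ℝ) : collarWidth w δ ≤ 1 / 2 := min_le_left _ _

/-- The clamped width tends to `0` as `δ → 0⁺` when `w` does. [folklore] -/
theorem tendsto_collarWidth (hw : Tendsto w (𝓝[>] 0) (𝓝 0)) :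
    Tendsto (collarWidth w) (𝓝[>] 0) (𝓝 0) := by
  have hid : Tendsto (fun δ : ℝ => δ) (𝓝[>] (0 : ℝ)) (𝓝 0) :=
    tendsto_id.mono_left nhdsWithin_le_nhds
  have h1 : Tendsto (fun δ => max (w δ) δ) (𝓝[>] 0) (𝓝 (max 0 0)) := hw.max hid
  rw [max_self] at h1
  refine tendsto_of_tendsto_of_tendsto_of_le_of_le' tendsto_const_nhds h1 ?_ ?_
  · filter_upwards [self_mem_nhdsWithin] with δ hδ using (collarWidth_pos w hδ).le
  · exact Eventually.of_forall fun δ => min_le_right _ _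

/-- Eventually (as `δ → 0⁺`) the clamped width is below any given positive threshold. [folklore] -/
theorem eventually_collarWidth_le (hw : Tendsto w (𝓝[>] 0) (𝓝 0)) {h₀ : ℝ} (hh₀ : 0 < h₀) :
    ∀ᶠ δ in 𝓝[>] (0 : ℝ), collarWidth w δ ≤ h₀ :=
  (tendsto_collarWidth w hw).eventually (Iic_mem_nhds hh₀)

/-- **The collar family** of the conformal rectangle `R` with signs `σ` and width `w δ`: the
3-marked domain `(Ω_δ; a′, b′, c′)` obtained by forgetting the fourth mark of the collar domain
`R.collarRect T σ (collarWidth w δ)` (the boundary of `Ω` pushed outwards along the arcs with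
`σᵢ > 0` and inwards along those with `σᵢ < 0`, through the corners; Bollobás–Riordan's
"longer, thinner" domain for `σ = (+,-,+,-)` and "shorter, fatter" one for `σ = (-,+,-,+)`), and
`(Ω; a′, b′, c′)` itself for `δ ≤ 0` (junk). [cite: BollobasRiordan2006, Ch. 7 p. 186, Fig. 14] -/
def collarFamily (hσ : ∀ i, |σ i| ≤ 1) : ℝ → MarkedDomain 3 := fun δ =>
  if hδ : 0 < δ then forgetLast (R.collarRect T hσ (collarWidth_pos w hδ) (collarWidth_le w δ))
  else forgetLast R

/-- The collar family at a positive mesh. [folklore] -/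
theorem collarFamily_of_pos (hσ : ∀ i, |σ i| ≤ 1) {δ : ℝ} (hδ : 0 < δ) :
    collarFamily R T σ w hσ δ =
      forgetLast (R.collarRect T hσ (collarWidth_pos w hδ) (collarWidth_le w δ)) :=
  dif_pos hδ

/-- The pointwise deviation of the collar loop of width `collarWidth w δ` from `∂Ω`, maximised over
two periods of the parameter (the arcs of the 3-marked domains use parameters in `[0, 2]`).
[folklore] -/
def collarDev (δ : ℝ) : ℝ :=
  sSup ((fun t => dist (R.collarLoop T σ (collarWidth w δ) t) (R.boundary t)) '' Icc (0 : ℝ) 2)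

/-- The deviation dominates the pointwise distance on `[0, 2]`. [folklore] -/
theorem dist_collarLoop_le_collarDev (hσ : ∀ i, |σ i| ≤ 1) {δ : ℝ} (hδ : 0 < δ) {t : ℝ}
    (ht : t ∈ Icc (0 : ℝ) 2) :
    dist (R.collarLoop T σ (collarWidth w δ) t) (R.boundary t) ≤ collarDev R T σ w δ := by
  have hcont : Continuous fun t => dist (R.collarLoop T σ (collarWidth w δ) t) (R.boundary t) :=
    (R.continuous_collarLoop T hσ (collarWidth_pos w hδ) (collarWidth_le w δ)).dist
      R.continuous_boundary
  exact le_csSup (isCompact_Icc.bddAbove_image hcont.continuousOn) (mem_image_of_mem _ ht)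

/-- The deviation is below `ε` as soon as all tube points of depth `≤ collarWidth w δ` are within
`ε/2` of the boundary. [folklore] -/
theorem collarDev_lt (hσ : ∀ i, |σ i| ≤ 1) {δ : ℝ} (hδ : 0 < δ) {ε h₀ : ℝ} (hε : 0 < ε)
    (hh₀ : ∀ s t, 1 - h₀ ≤ s → s ≤ 1 + h₀ → dist (T.tube s t) (R.boundary t) < ε / 2)
    (hle : collarWidth w δ ≤ h₀) : collarDev R T σ w δ < ε := by
  have hne : ((fun t => dist (R.collarLoop T σ (collarWidth w δ) t) (R.boundary t)) ''
      Icc (0 : ℝ) 2).Nonempty := ⟨_, mem_image_of_mem _ (left_mem_Icc.2 (by norm_num))⟩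
  refine lt_of_le_of_lt (csSup_le hne ?_) (half_lt_self hε)
  rintro _ ⟨t, -, rfl⟩
  exact (R.dist_collarLoop_lt T hσ (collarWidth_pos w hδ) hh₀ hle t).le

/-- The deviation tends to `0` as `δ → 0⁺` (uniform convergence of the tube to `∂Ω`,
`exists_dist_tube_lt`). [folklore] -/
theorem tendsto_collarDev (hσ : ∀ i, |σ i| ≤ 1) (hw : Tendsto w (𝓝[>] 0) (𝓝 0)) :
    Tendsto (collarDev R T σ w) (𝓝[>] 0) (𝓝 0) := by
  rw [Metric.tendsto_nhds]
  intro ε hε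
  obtain ⟨h₀, hh₀, -, hdist⟩ := T.exists_dist_tube_lt (half_pos hε)
  filter_upwards [eventually_collarWidth_le w hw hh₀, self_mem_nhdsWithin] with δ hle hδ
  have h0 : 0 ≤ collarDev R T σ w δ :=
    le_trans dist_nonneg (dist_collarLoop_le_collarDev R T σ w hσ hδ (left_mem_Icc.2 (by norm_num)))
  rw [Real.dist_0_eq_abs, abs_of_nonneg h0]
  exact collarDev_lt R T σ w hσ hδ hε hdist hle

/-- The arcs of the collar family are the collar loop read on the parameter intervals of the arcs
of `(Ω; a′, b′, c′)` (same marks). [folklore] -/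
theorem collarFamily_arc (hσ : ∀ i, |σ i| ≤ 1) {δ : ℝ} (hδ : 0 < δ) (i : Fin 3) :
    (collarFamily R T σ w hσ δ).arc i =
      (fun t => R.collarLoop T σ (collarWidth w δ) t) ''
        Icc ((forgetLast R).mark i) ((forgetLast R).nextMark i) := by
  rw [collarFamily_of_pos R T σ w hσ hδ]
  rfl

/-- The parameter intervals of the arcs of a 3-marked domain lie in `[0, 2]`. [folklore] -/
theorem Icc_mark_subset (D : MarkedDomain 3) (i : Fin 3) :
    Icc (D.mark i) (D.nextMark i) ⊆ Icc (0 : ℝ) 2 := by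
  intro t ht
  have h0 := (D.mark_mem i).1
  have h1 := (D.mark_mem i).2
  have h2 := D.nextMark_le_mark_add_one i
  exact ⟨h0.trans ht.1, by linarith [ht.2]⟩

/-- **Collar families are approximating families.** For every conformal rectangle `R`, tube data
`T`, signs `|σᵢ| ≤ 1` and widths `w δ → 0` (`δ → 0⁺`), the collar family satisfies `UJApprox`:
its arcs are pointwise (same parameter) within the deviation `collarDev → 0` of the arcs of
`(Ω; a′, b′, c′)`, and every compactum `K ⊆ Ω` — which lies in `Φ(B̄(0, r))` for some `r < 1` —
is inside the collar domain as soon as the width is `< 1 - r` and the collar loop is closer to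
`∂Ω` than the depth of the centre (`apply_mem_collarRect`). These are the inner/outer
approximations `T^∓` proposed for the stub. [cite: BollobasRiordan2006, Ch. 7 Lemma 14 p. 184, p. 186] -/
theorem ujApprox_collarFamily (hσ : ∀ i, |σ i| ≤ 1) (hw : Tendsto w (𝓝[>] 0) (𝓝 0)) :
    UJApprox R (collarFamily R T σ w hσ) := by
  refine ⟨⟨collarDev R T σ w, tendsto_collarDev R T σ w hσ hw, ?_⟩, ?_⟩
  · filter_upwards [self_mem_nhdsWithin] with δ hδ i
    have hδ' : (0 : ℝ) < δ := hδ
    rw [collarFamily_arc R T σ w hσ hδ' i]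
    constructor
    · rintro z ⟨t, ht, rfl⟩
      refine ⟨_, ⟨t, ht, rfl⟩, ?_⟩
      rw [dist_comm]
      exact dist_collarLoop_le_collarDev R T σ w hσ hδ' (Icc_mark_subset _ i ht)
    · rintro y ⟨t, ht, rfl⟩
      exact ⟨_, ⟨t, ht, rfl⟩, dist_collarLoop_le_collarDev R T σ w hσ hδ' (Icc_mark_subset _ i ht)⟩
  · intro K hK hKΩ
    -- `K ⊆ Φ(B̄(0, r))` for some `r < 1`
    have hKc : IsCompact (T.Ci.φ.symm '' K) :=
      hK.image_of_continuousOn (T.Ci.φ.symm.continuousOn.mono hKΩ)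
    have hKball : T.Ci.φ.symm '' K ⊆ ball (0 : ℂ) 1 := by
      rintro _ ⟨x, hx, rfl⟩
      have := T.Ci.φ.symm.toPartialEquiv.map_source (x := x)
        (by rw [T.Ci.φ.symm.source_eq]; exact hKΩ hx)
      rwa [T.Ci.φ.symm.target_eq] at this
    obtain ⟨r, hr1, hKr⟩ : ∃ r < 1, ∀ u ∈ T.Ci.φ.symm '' K, ‖u‖ ≤ r := by
      rcases (T.Ci.φ.symm '' K).eq_empty_or_nonempty with h0 | hne
      · exact ⟨0, one_pos, by rw [h0]; simp⟩
      · obtain ⟨u₀, hu₀, hmax⟩ := hKc.exists_isMaxOn hne continuous_norm.continuousOn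
        exact ⟨‖u₀‖, mem_ball_zero_iff.1 (hKball hu₀), fun u hu => hmax hu⟩
    -- the depth of the centre
    have hd₀ : 0 < infDist T.z₀ (frontier R.carrier) := by
      have hne : (frontier R.carrier).Nonempty := ⟨_, R.boundary_mem_frontier 0⟩
      refine (isClosed_frontier.notMem_iff_infDist_pos hne).1 fun hz => ?_
      exact Set.disjoint_left.1 R.disjoint_carrier_frontier T.hz₀ hz
    obtain ⟨h₀, hh₀, -, hdist⟩ := T.exists_dist_tube_lt hd₀
    have hsmall : ∀ᶠ δ in 𝓝[>] (0 : ℝ), collarWidth w δ < 1 - r :=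
      (tendsto_collarWidth w hw).eventually (Iio_mem_nhds (by linarith))
    filter_upwards [eventually_collarWidth_le w hw hh₀, hsmall, self_mem_nhdsWithin] with δ hle hlt hδ
    have hδ' : (0 : ℝ) < δ := hδ
    intro x hx
    rw [collarFamily_of_pos R T σ w hσ hδ', forgetLast_carrier]
    have hclose : ∀ t, dist (R.collarLoop T σ (collarWidth w δ) t) (R.boundary t) <
        infDist T.z₀ (frontier R.carrier) := fun t =>
      R.dist_collarLoop_lt T hσ (collarWidth_pos w hδ') hdist hle t
    have hxΩ := hKΩ hx
    have hux : T.Ci.Φ (T.Ci.φ.symm x) = x := by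
      rw [T.Ci.eqOn (hKball ⟨_, hx, rfl⟩)]
      exact T.Ci.φ.apply_symm_apply hxΩ
    rw [← hux]
    refine R.apply_mem_collarRect T hσ (collarWidth_pos w hδ') (collarWidth_le w δ) hclose ?_
    exact lt_of_le_of_lt (hKr _ ⟨_, hx, rfl⟩) (by linarith)

end Collar

/-- **Registered glue sub-goal `stub_ujCollarApprox`** of crux `UnionJackMorera` (line
`registered`): for every conformal rectangle, tube data, signs `|σᵢ| ≤ 1` and widths `w δ → 0`
(`δ → 0⁺`), the collar family is an approximating family in the sense of `UJApprox` — the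
statement of `ujApprox_collarFamily` with all parameters bound (Bollobás–Riordan 2006, Ch. 7,
Lemma 14 p. 184 and p. 186: the longer–thinner / shorter–fatter domains are `o(1)`-close to
`D`). [cite: BollobasRiordan2006, Ch. 7 Lemma 14 p. 184, p. 186] -/
theorem stub_ujCollarApprox : ∀ (R : ConformalRectangle) (𝒯 : R.toJordanDomain.TubeData) (σ : Fin 4 → ℝ) (w : ℝ → ℝ) (hσ : ∀ i, |σ i| ≤ 1), Tendsto w (𝓝[>] 0) (𝓝 0) → UJApprox R (collarFamily R 𝒯 σ w hσ) :=
  fun R 𝒯 σ w hσ hw => ujApprox_collarFamily R 𝒯 σ w hσ hw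

end Summit.CriticalPhenomena.CardyFormulaZ2.Cruxes.UnionJackMorera.Birth

end
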